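import Mathlib
import HarnessLib
import HarnessLib.Audit
import Summits.AnomalousDissipation.Statement
import Literature.Analysis.FluidPDE.NSGalerkinFourier
import HarnessLib.Audit.Status.Attr

/-!
Route: WindLine

CLOSED (retired) 2026-08-17T14:50:35Z by planner-rbadge-AnomalousDissipation-WindLine-c56b32b7-g2-0 — reason: not-a-thesis (restated, RULE-N): badge g2 on skeleton.hides-summit (11414) — the only open load-bearing binder of closes, CyclicWindLineLoud (11415), is ≥ summit by a closed tree term (closes ∘ landed 11421–11424; LeafStrength.lean rc 0), c — note: CENSUS (full text: evidence CLOSE-CENSUS.md on this route and on stmt-11415). TRIED: X = WindyGalerkinSteadyZerothLaw worked directly (line birth revs 1–8: heart → A dense loud designer forces → P non-meagre → P′ menu form — each kernel-checked ≥ CoherentStates.SteadyZerothLaw 0219 and ≥ S; P′ ⇒ S =. The file is kept as the record of this route; refuted decls are indexed as negative knowledge (`ledger negatives`).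

# Route WindLine — conserved momentum as a ν-uniform continuation axis — windy steady Galerkin
states decide the zeroth law

It suffices to show X = WindyGalerkinSteadyZerothLaw (card approach-from-the-wind, spine): a smooth
divergence-free mean-zero steady
force f on T³, viscosities ν_j → 0⁺ and constants E, ε > 0 such that for every j and INFINITELY MANY
resolutions N there is a
Fourier–Galerkin steady state u — smooth, divergence free, band-limited to |k| ≤ N WITH THE MEAN
MODE FREE (u = c + U, momentum
c = ∫u arbitrary), solving the tested Galerkin equations ∫⟨u,(u·∇)a⟩ + ν_j⟨u,Δa⟩ + ⟨f,a⟩ = 0 for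
every smooth divergence-free a
band-limited to 0 < |k| ≤ N — with total energy ∫|u|² = |c|² + ∫|U|² ≤ E and dissipation ν_j‖∇u‖² ≥
ε. Windy steady states are
admitted VERBATIM by the summit (u is a global Leray–Hopf solution from itself; meanEnergy = |c|² +
∫|U|², meanDissipation = ν‖∇U‖²):
the momentum is booked, never hidden. X is route MirrorVariety's GalerkinSteadyZerothLaw with the
clause HasZeroMean deleted — the
conserved momentum is the line's SECOND CONTINUATION AXIS, and the cruxes say where on it loud
states are reached (the wind-line).
Lean: `∃ f : UnitAddTorus (Fin 3) → EuclideanSpace ℝ (Fin 3),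
Literature.Analysis.FunctionSpaces.Torus.IsSmooth f ∧
Literature.Analysis.FunctionSpaces.Torus.IsDivFree f ∧
Literature.Analysis.FunctionSpaces.Torus.HasZeroMean f ∧ ∃ (ν : ℕ → ℝ) (E ε : ℝ), (∀ j, 0 < ν j) ∧
Filter.Tendsto ν Filter.atTop (nhds 0) ∧ 0 < ε ∧ ∀ j, ∃ᶠ N in Filter.atTop, ∃ u : UnitAddTorus (Fin
3) → EuclideanSpace ℝ (Fin 3), (Literature.Analysis.FunctionSpaces.Torus.IsSmooth u ∧
Literature.Analysis.FunctionSpaces.Torus.IsDivFree u ∧ (∀ k ∉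
Literature.Analysis.FunctionSpaces.Torus.freqBall N, UnitAddTorus.mFourierCoeff
(Literature.Analysis.FunctionSpaces.EuclideanSpace.complexify ∘ u) k = 0) ∧ ∀ a : UnitAddTorus (Fin
3) → EuclideanSpace ℝ (Fin 3), Literature.Analysis.FunctionSpaces.Torus.IsSmooth a →
Literature.Analysis.FunctionSpaces.Torus.IsDivFree a → (∀ k ∉
(Literature.Analysis.FunctionSpaces.Torus.freqBall N).erase (0 : Fin 3 → ℤ),
UnitAddTorus.mFourierCoeff (Literature.Analysis.FunctionSpaces.EuclideanSpace.complexify ∘ a) k = 0)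
→ ∫ x, (inner ℝ (u x) (Literature.Analysis.FunctionSpaces.Torus.convect u a x) + ν j * inner ℝ (u x)
(Literature.Analysis.FunctionSpaces.Torus.laplacian a x) + inner ℝ (f x) (a x)) = 0) ∧ ∫ x, ‖u x‖ ^
2 ≤ E ∧ ε ≤ ν j * Literature.Analysis.FunctionSpaces.Torus.gradNormSq u`

## Assembly
Deciding theorem (re-glued 2026-08-17, every hypothesis consumed): `closes : CyclicWindLineLoud →
WindySteadyLimit → WindySteadyIsLerayHopf → WindLineFeedsTarget → Assembly → AnomalousDissipation :=
fun hC hL hH hF hA => hA (hF hC) hL hH` — WindLineFeedsTarget (PROVED) turns #2 into X, and the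
PROVED Assembly item is the composition X → WindySteadyLimit → WindySteadyIsLerayHopf →
AnomalousDissipation, pure logic given the two glue supports (both PROVED): from X take
f, ν_j, E, ε; for each j, WindySteadyLimit at ν = ν_j turns the windy Galerkin states at infinitely
many N into a steady field u_j with
∫|u_j|² ≤ E and ν_j‖∇u_j‖² = (f, u_j) ≥ ε; WindySteadyIsLerayHopf makes the constant path a global
Leray–Hopf solution from u_j with
meanEnergy = ∫|u_j|² ≤ E and meanDissipation = ν_j‖∇u_j‖² ≥ ε — verbatim the witnesses (f, ν, u₀ j
:= u_j, u j := const u_j) of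
Literature.Turb.ZerothLaw = AnomalousDissipation. X itself is the derived target (not a hypothesis
of `closes`): CyclicWindLineLoud → X (WindLineFeedsTarget, proved); the calm case
c = 0 is MirrorVariety's X, which implies ours trivially (2986 → X landed), and TaylorCertificates'
13038 → X is landed too.

Rationale: WHY THIS LINE. Since ∫f = 0 the momentum c is conserved, and lab-frame steady states with c = s·e
solve s(e·∇)U + P(U·∇)U = νΔU + f: at resolution N
they are the zeros of the tree's own `galerkinRHS` on the FULL ball `freqBall N` (the Leray symbol
keeps the mean mode and the k = 0
component of the field vanishes on transversal vectors, so c₀ = s·e is a free real coordinate — no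
new definition). Three exact facts
organise the (ν,s)-surface: the wind does no work (ν·4π²Σ|k|²|c_k|² = Re⟨g,c⟩, s-independent); for a
non-resonant direction e the
operator 4π²ν|k|² + 2πi s(e·k) is normal with modulus ≥ 2π|s|·min|e·k|, so a contraction gives a
unique small wake for |s| ≥ s₀ with
constants INDEPENDENT of ν ∈ [0,∞) — a laminar shore that, unlike the Stokes shore ν = ∞, touches ν
= 0 (in the tree for the first
mode: `marchioroDriftState`, Λ_k = 4π²ν|k|² + 2πi(m·k); in the continuum: BaldiMontalto2021 Thm 1.1,
FranzoiMontalto2022); and at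
fixed ν > 0 the component of the windy variety containing the shore is a line from s = +∞ to s = −∞
that must cross the calm slice
(parity of generic steady-state counts, FoiasTemam1977 / TemamNSNFA1995 Thm 10.4, run along s
instead of f). Reaching states
disconnected from the laminar branch through an auxiliary PHYSICAL parameter and then removing it is
how Nagata1990 (rotation) and
Waleffe2003 (artificial forcing) found the exact coherent states of linearly stable shear flows;
here the parameter is a conserved
quantity of the problem itself and every intermediate state is summit-admissible. Imported areas:
numerical/analytic bifurcation
theory (Keller arclength continuation, BrezziRappazRaviart1980, SchreiberKeller1983,
FranceschiniTebaldiZironi1984), real-algebraic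
and differential topology (BasuPollackRoy2006 Thm 5.21–5.22, MilnorTDV1965: 1-manifold
classification), KAM for fluids
(BaldiMontalto2021, FranzoiMontalto2022, KhesinKuksinPeraltasalas2014). What no prior route does:
MirrorVariety continues in ν (and
through the unphysical mirror ν < 0) inside the mean-zero class and its LaminarNeverLoud predicts
that ν-continuation never reaches
loud states; this line continues in s at FIXED small ν from a ν-uniformly bounded object, turns
folds instead of wading through the
ν⁻² laminar sea, and admits the windy states the negatives index (stmt-2979/2984: momentum-carrying
data) showed the summit accepts.

RANKED CRUXES. #0 WindyGalerkinSteadyZerothLaw (target, DERIVED — not staffed directly since the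
2026-08-17 badge repair) — X as in § Thesis — loud bounded steady Galerkin states with free
momentum, along ν_j → 0⁺, at infinitely many resolutions (card K1 without the reachability clause;
MirrorVariety's target minus HasZeroMean). X is reached inside the route by the PROVED glue
WindLineFeedsTarget (#2 → X) and from two sibling cruxes by landed edges
(TaylorCertificates.SteadyStatesLoudBounded 13038 → X,
Theorems/WindLineWindyGalerkinSteadyZerothLawOfSteadyStatesLoudBounded;
MirrorVariety.GalerkinSteadyZerothLaw 2986 → X, calm ⊂ windy); it is no longer a hypothesis of
`closes`, whose open leaf is #2. (why it might fail: False if bounded-energy steady states, windy or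
calm, laminarise as ν→0 (momentum-inclusive SteadyNeg 0222 + WindySteadyLimit); at fixed N bounded
states are quiet (ν‖∇u‖² ≤ 4π²νN²E): witnesses need N ≳ (ε/νE)^½ and Onsager-rough limits; the windy
shore itself is quiet.) [Temam1979, ConstantinFoias1988, DoeringFoias2002, Cheskidov2023,
DrivasEyink2019]
#2 CyclicWindLineLoud (crux) — card K1 made precise for ONE force and ONE wind direction: for the
cyclic force f(x) = (sin 2πx₃, sin 2πx₁, sin 2πx₂) (odd, first-shell, genuinely three-dimensional)
and e = (1, √2, √3) (e·k ≠ 0 for every k ∈ ℤ³∖0) there are ν_j → 0⁺, E, ε > 0 such that for every j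
and infinitely many N the WIND-LINE — the connected component of the fixed-ν_j windy steady Galerkin
variety V = {c ∈ galerkinSubspace(freqBall N) : c₀ ∈ ℝ·e, galerkinRHS ν_j ĝ c = 0} that reaches
arbitrarily large wind s — carries a state of total energy Σ|c_k|² ≤ E and dissipation
ν_j·4π²Σ|k|²|c_k|² ≥ ε. Feeds the target through WindLineFeedsTarget (PROVED) and is, since the
2026-08-17 re-glue, the sole OPEN load-bearing hypothesis of `closes`; registered skeleton
Cruxes/CyclicWindLineLoud/Lines/birth.lean (far-shore stubs landed p143523/p145058; open:
stub_windLineReachesBoundedCalm, stub_windLineLoudIfBoundedCalm). [difficulty: XL] (why it might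
fail: The wind-line may meet bounded energy only at warm states: in kit j001712 (K²=6) crossing
loudness fell from 0.69–1.46 (ν=10⁻²) to ≤0.29 (ν=10⁻³) under ⟨|U|²⟩≤60, tracking the cap νK²E;
N-uniform loudness at bounded energy was never observed; WindNeverLoud may be true.) [Nagata1990,
Waleffe2003, FranceschiniTebaldiZironi1984, Okamoto1998, BrachetEtAl1983]
#3 WindLineAvoidsLaminar (DROPPED 2026-08-17 — moot item stmt-11416, statement kept on the ledger
and in git rev ≤ 3; never in the cone of `closes`, its refutation is not a kill; formerly crux rank
3; re-file under a thesis that consumes it) — the structural claim behind "from the wind, not from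
honey" (card mechanism (3) plus the j001712 observation, filed instead of the card's 2-parameter
connectedness conjecture K3 — see § Not decomposed yet): for the cyclic force and e = (1,√2,√3)
there is ν₀ > 0 such that for every 0 < ν < ν₀ and all large N, NO calm crossing of the wind-line (a
calm state c, c₀ = 0, whose component in the fixed-ν windy variety reaches arbitrarily large s) lies
on the LAMINAR component of the calm variety (the component of {(c, ν') : c₀ = 0, galerkinRHS ν' ĝ c
= 0} reaching arbitrarily large ν', i.e. everything ν-continuation from Stokes can reach —
MirrorVariety's laminar component). Wind continuation at fixed small ν therefore lands only on
states that ν-continuation never sees (isolas/arches of the calm slice): combined with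
MirrorVariety.LaminarNeverLoud it says the wind reaches exactly the part of the variety where loud
states can live; combined with WindLineReachesCalm it produces non-laminar calm steady states at
every small ν constructively. [difficulty: L] (why it might fail: Evidence is K²=6 only (j001712:
all 46/89 calm crossings strictly louder than, hence distinct from, the Stokes-connected state); at
higher resolution new folds may route the wind-line through the laminar state, and if ν₀ must shrink
with N the statement is false as quantified (∃ν₀ ∀ν<ν₀ ∀ᶠN).) [Nagata1990, OkamotoShoji1993,
Okamoto1998, FoiasTemam1977, SchreiberKeller1983]
#4 WindNeverLoud (crux) — the negative universal of the line (kill criterion as a statement): for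
every smooth divergence-free mean-zero force f, every direction e with e·k ≠ 0 on ℤ³∖0 and every E,
ε > 0 there is ν₀ > 0 such that at EVERY resolution N and every 0 < ν < ν₀, every point of the
wind-line (component of the fixed-ν windy variety reaching arbitrarily large s) with total energy ≤
E has dissipation ν·4π²Σ|k|²|c_k|² < ε. Trivial at fixed N (νN²E); the content is uniformity in N.
WindNeverLoud → ¬CyclicWindLineLoud (e = (1,√2,√3) is non-resonant; LANDED as Theorems
…CyclicWindLineLoud.Negative.CyclicWindLineLoud_false_of_WindNeverLoud — the kill path; for that
reason #4 is an item but NOT a hypothesis of `closes`); it is the wind-axis twin of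
MirrorVariety.LaminarNeverLoud (stmt-2988), about a different component (fixed ν, varying s, instead
of s = 0, varying ν). [difficulty: XL] (why it might fail: False as soon as one smooth force has
loud bounded wind-line states at unbounded resolution (CyclicWindLineLoud): all 135 calm crossings
of j001712 are ×1.6–7 louder than the Stokes-connected state and sit at 70–80% of the cap; no
a-priori 3-D bound controls interior crossings.) [AlexakisDoering2006PLA, Cheskidov2023,
OkamotoShoji1993, LucasKerswell2017, FoiasManleyRosaTemam2001]
#5 InviscidWindyShore (DROPPED 2026-08-17 — moot item stmt-11418, statement kept on the ledger and
in git rev ≤ 3; never in the cone of `closes`; the ν-uniform shore #2 needs is the PROVED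
Galerkin-level WindyShoreUniform; formerly crux rank 5; re-file as a crux of a continuum wind-line
thesis) — card K2, the part that can be typed now — the windy shore touches ν = 0 IN THE CONTINUUM:
for the cyclic force there are a direction e ≠ 0, towing speeds s_n → ∞ and C such that for every n
a smooth divergence-free mean-zero wake U solves the steady Euler equations with momentum s_n·e in
tested form, ∫⟨s_n e + U, ((s_n e + U)·∇)a⟩ + ⟨f, a⟩ = 0 for all smooth divergence-free a, with s_n²
∫|U|² ≤ C (steady KAM wakes behind a fast Diophantine drift; after the scaling u ↦ u/s this is
steady forced Euler near the constant field e with force f/s², the zero-time-frequency case of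
BaldiMontalto2021). The inviscid invariant s*(f) (critical towing speed) of the card is the infimum
of the continuation of this family and is NOT filed yet. [difficulty: XL] (why it might fail: Small
divisors of (e·∇)⁻¹ plus the derivative loss of (U·∇)U force Nash–Moser with Melnikov excision in
the drift: BaldiMontalto2021 Thm 1.1 gives H^s solutions for (ω,ζ) of asymptotically full measure,
ν≥1 time frequencies, small force; the steady zero-frequency C^∞ case is not in print.)
[BaldiMontalto2021, FranzoiMontalto2022, KhesinKuksinPeraltasalas2014, ArnoldKhesin1998]
#9 WindyShoreUniform (support, PROVED) — card P1(a), provable now: the ν-UNIFORM windy shore at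
Galerkin level. For every N, real solenoidal g with g₀ = 0 and e non-resonant on freqBall N there is
C such that for every energy radius R there is s₀ with: for all ν ≥ 0 and |s| ≥ s₀ a windy steady
state with c₀ = s·e exists with s²·Σ_{k≠0}|c_k|² ≤ C, and it is the only windy steady state at (ν,
s) among those with Σ_{k≠0}|c_k|² ≤ R (contraction for c̃ = M⁻¹(g − B̃(c̃,c̃)), M_k = 4π²ν|k|² + 2πi
s(e·k) normal with |M_k| ≥ 2π|s| min|e·k|; the tree's marchioroDriftState is the N = 1, 2-D
instance). [difficulty: provable-now] [RobinsonRodrigoSadowski2016, ConstantinFoias1988,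
BaldiMontalto2021, FoiasManleyRosaTemam2001]
#9 WindLineReachesCalm (support, PROVED) — card P1(b), the odd-crossing theorem in its provable
core: at fixed ν > 0, resolution N, real solenoidal g with g₀ = 0, non-resonant e, if 0 is a regular
value of c ↦ galerkinRHS ν g c on the affine windy phase space {c ∈ galerkinSubspace : c₀ ∈ ℝ·e},
then every point whose connected component in the windy variety reaches arbitrarily large s also
reaches arbitrarily negative s in its component, and that component contains a CALM steady state (c₀
= 0). Proof map: energy identity ⇒ ‖c̃‖ ≤ ‖g‖/(4π²ν) uniformly in s (slabs |s| ≤ Λ compact);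
WindyShoreUniform ⇒ V ∩ {s > s₁} and V ∩ {s < −s₁} are single arcs; regular value ⇒ V is a closed
1-manifold, the component of the +∞ arc is a properly embedded line whose two ends cannot both run
into the single +∞ arc; intermediate value theorem on s. [difficulty: M] [MilnorTDV1965,
BasuPollackRoy2006, FoiasTemam1977, TemamNSNFA1995, Temam1979]
#9 WindySteadyLimit (support, PROVED) — assembly glue, provable now from tree material (Temam's
existence proof run on the given zeros): at fixed ν > 0, from windy Galerkin states at infinitely
many N with ∫|u_N|² ≤ E and ν‖∇u_N‖² ≥ ε extract u ∈ L² ∩ H¹, weakly divergence free, solving the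
steady tested equations against ALL smooth divergence-free fields (constants test trivially since ∫f
= 0), with ∫|u|² ≤ E, the ENERGY EQUATION ν‖∇u‖² = (f, u) (d = 3: b(u,u,ũ) = 0 for u ∈ H¹, ũ = u −
∫u) and hence ν‖∇u‖² = lim (f, u_N) = lim ν‖∇u_N‖² ≥ ε (testing the Galerkin equations with a = u_N
− ∫u_N gives ν‖∇u_N‖² = (f, u_N) ≤ ‖f‖√E, the uniform H¹ bound; means |∫u_N|² ≤ E). [difficulty:
provable-now] [Temam1979, ConstantinFoias1988, RobinsonRodrigoSadowski2016, Galdi2011]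
#9 WindySteadyIsLerayHopf (support, PROVED) — assembly glue, provable now: a field u ∈ L² ∩ H¹ on
T³, weakly divergence free, solving the steady tested Navier–Stokes equations against all smooth
divergence-free fields for a smooth mean-zero force f, with the energy equation ν‖∇u‖² = (f, u), is
— as the constant path — a global Leray–Hopf solution from itself (weak form: the time derivative
term integrates to −∫⟨u, ψ(0)⟩ and cancels the datum; energy inequalities hold with equality;
weak/strong continuity trivial), with meanEnergy = ∫|u|² and meanDissipation = ν‖∇u‖² (time means of
constants). No mean-zero hypothesis anywhere: Torus.IsWeakNSSolutionForcedOn imposes none (cf. the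
tree's marchioroSweptState_isGlobalLerayHopf and the constant-flow witness of
FrustratedForcesEnsembleCeilingBridge_refuted). [difficulty: provable-now] [Galdi2000,
DoeringFoias2002, RobinsonRodrigoSadowski2016, Hopf1951]
#9 WindLineFeedsTarget (support, PROVED) — glue, provable now: CyclicWindLineLoud →
WindyGalerkinSteadyZerothLaw. A zero c of galerkinRHS on freqBall N is the coefficient vector of u =
realTrigPoly (coeffExt c): smooth, divergence free (isDivFree_realTrigPoly), band-limited to
freqBall N, solving the tested equations by sum_re_inner_galerkinField_test, with ∫|u|² = Σ|c_k|²
and gradNormSq u = 4π²Σ|k|²|c_k|² (Parseval); the cyclic force is smooth, divergence free, mean zero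
and its coefficient vector is real solenoidal. [difficulty: provable-now]
[RobinsonRodrigoSadowski2016, ConstantinFoias1988]

TWO-LAYER PLAN. Foreseen glued splits (none filed now; k ≤ 3, depth 1): CyclicWindLineLoud ⇐
FarShoreOnWindLine (LANDED) → WindLineReachesBoundedCalm (a wind-reached calm state inside a
ν-uniform energy ball, ∀ small ν ∀ᶠ N) → WindLineLoudIfBoundedCalm (ν-uniform injected-power floor
on bounded calm crossings) → CyclicWindLineLoud — exactly the registered skeleton, whose composition
CyclicWindLineLoud_of is kernel-checked in Cruxes/CyclicWindLineLoud/Lines/birth.lean; TENURE: once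
that composition is landed under Theorems (--supports 11415) split #2 into these two children with
--glue-by, so the cone of `closes` shows two load-bearing cruxes (the diagonal cut DiagonalLoudness
→ PropagationInN of the open is withdrawn: diagonal loud states saturate the Bernstein cap 4π²νN²E
and do not persist in N); WindNeverLoud ⇐ CalmCrossingsWarm
(calm crossings of the wind-line have ν‖∇U‖² ≤ C(f)ν^θ uniformly in N) → WindyInteriorWarm →
WindNeverLoud; InviscidWindyShore (dropped item 11418; if re-filed) ⇐
SteadyBaldiMontalto (zero-frequency Thm 1.1, H^s) → Bootstrap (analytic force ⇒ C^∞ wakes) →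
InviscidWindyShore — banked with the item.

KILL CRITERIA. ¬WindyGalerkinSteadyZerothLaw (e.g. a momentum-inclusive steady no-anomaly theorem
composed with WindySteadyLimit) closes the route
`refuted:WindyGalerkinSteadyZerothLaw`. WindNeverLoud PROVED kills the mechanism (wind continuation
never reaches loud states for any
force): close `refuted:CyclicWindLineLoud` unless a loud windy state has meanwhile been found off
the wind-line, in which case the
target migrates to MirrorVariety (superseded). CyclicWindLineLoud refuted for this (force,
direction) only ⇒ ONE pivot (Taylor–Green
force of MirrorVariety #2 with e = (1,√2,√3), then the two-shear Kolmogorov force) before closing.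
WindLineAvoidsLaminar (dropped as an item 2026-08-17; the statement stands as context) refuted (the
wind-line passes through the laminar state at small ν, large N) is NOT a kill: the wind still
reaches the other (odd number minus one)
crossings; it demotes the 'not from honey' claim and re-ranks #2 below #4. InviscidWindyShore
(dropped as an item 2026-08-17) refuted removes the
inviscid organising number s*(f) but not the Galerkin shore; the route continues. MirrorVariety's
GalerkinSteadyZerothLaw proved ⇒ our target follows (calm ⊂ windy) and the route is superseded by
MirrorVariety; SteadyNeg (0222)
proved kills only the calm witnesses, not the windy ones.

NOT DECOMPOSED YET. The critical towing speed s*(f) := inf{s : the inviscid wind-line reaches s} and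
the blow-up alternative at s ↓ s* (card K2 proper:
needs a continuation family in function space; filed once InviscidWindyShore lands); the odd COUNT
of calm crossings (transversality
+ mod-2 degree; only existence of a calm crossing is filed, in WindLineReachesCalm); uniqueness
threshold s₁(ν) = C‖g‖β_N/(ν·min|e·k|)
and the wind-does-no-work identity (ride as `--supports` lemmas under WindyShoreUniform /
WindLineReachesCalm); the card's conjecture K3
(connectedness of the steady surface over the (ν,s) half-plane for generic g: not filed —
2-parameter connectedness neither feeds #2 at
fixed ν nor excludes sheets attached to ν = 0⁺, and islands are plausibly generic; kept as a
question for tenure); the full 3-vector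
wind (resonant directions e·k = 0, where the shore fails); time-periodic windy states; certified (ν,
N) milestones and the wind
continuation protocol of kit j001712 (evidence under #2/#4, not items).

CHEAPEST FALSIFIER. The DIAGONAL wind run the card names but did not finish: cyclic force, e ∝
(1,√2,√3), K² = 10, ν = 10⁻³, continue the wind-line from
s = 40 down through 0 (compute/galerkin_steady2.py of card j001712; the cap νK²E allows loudness 0.6
at ⟨|U|²⟩ = 60): if every
wind-line point with ⟨|U|²⟩ ≤ 60 has ν‖∇U‖² ≤ 0.1 while K² = 6 gave 0.29, loudness does not follow
the Taylor diagonal and #2 is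
moribund (#4 gains). Second, for #3: in the same runs (K² = 8, 10, ν = 10⁻², 10⁻³) test whether ANY
calm crossing of the wind-line coincides with the
ν-continued Stokes state (distance in coefficient space below solver tolerance) — one coincidence at
two successive resolutions kills #3.
Neither was run in this plancard session (no compute in this mode).

NUMBERS. Quiet cap at fixed resolution: ν‖∇u‖² ≤ 4π²νN²·E for band-limited u with ∫|u|² ≤ E. Cyclic
force: ‖f‖₂² = 3/2, first shell, laminar
state f/(4π²ν). Card computation kit j001712 (K² = 6, e ∝ (1,√2,√3), s from 40 to 0): ν = 10⁻² — 46
calm crossings, loudness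
ν‖∇U‖² ∈ [0.69, 1.46] at ⟨|U|²⟩ ∈ [16, 34] versus 0.42 at 6.4 on the Stokes-connected state; ν =
10⁻³ — 89 crossings before the fold
cap, loudness ≤ 0.29 under ⟨|U|²⟩ ≤ 60 (0.49 under 120, 1.88 at 400) versus 0.04 at 6.7; crossings
carry 70–80 % of the cap νK²⟨|U|²⟩;
crossing lists palindromic with one self-symmetric middle crossing (odd count), as (U,s) ↦
(−U(−·),−s) predicts for the odd force.
Windy shore threshold (Galerkin): s₀ ≍ (β_N‖g‖)^{1/2}/(2π m_N), m_N = min_{0<|k|≤N} |e·k| (m = 1 on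
the first shell, 2−√3 ≈ 0.27 by
|k|² = 5 for e = (1,√2,√3)); wake size ‖c̃‖ ≤ 2‖g‖/(2π|s|m_N) for all ν ≥ 0. BaldiMontalto2021 Thm
1.1: force ε·f, solutions of size
Cε^b, parameters in Ω_ε with |Ω∖Ω_ε| → 0. Items at open: 11 (1 target, 4 cruxes, 5 supports, 1
assembly); after the 2026-08-17 badge repair: 9 (1 derived target, 2 cruxes #2/#4, 5 glue supports —
all PROVED, 1 assembly — PROVED; #3/#5 dropped → moot 11416/11418); `closes` consumes 5 binders (#2
+ 4 proved items), open leaf = #2.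

DEFINITION REQUESTS. None. The card's D1 (windy Galerkin steady map) is
`Literature.Analysis.FluidPDE.galerkinRHS` on the full ball `freqBall N`: the
Leray symbol `leraySym 0 = id` keeps the mean mode, the k = 0 component of `galerkinField` vanishes
identically on transversal
coefficient vectors (Σ_m 2πi(c_{−m}·m)c_m = 0), and the l = 0 terms of `convectionCoeff` are exactly
the wind 2πi(c₀·k)c_k. Every
other notion (galerkinSubspace, realTrigPoly, IsGlobalLerayHopf, meanEnergy, meanDissipation,
MemSobolev, IsWeaklyDivFree,
eGradNormSq, connectedComponentIn, fderiv) exists; all eleven Props elaborate (planner Sketch.lean,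
lean check rc 0).

CONE FACTS (route-repair, 2026-08-15). Gate deps cone: 62 project constants, 0 unproved, staffable
(deciding theorem native-OK). The three unproved named facts in the module import closure —
Literature.Analysis.FluidPDE.ZerothLawNeg (@[conjecture], open; the negative side of the summit),
Literature.Analysis.FluidPDE.ZerothLawTimePeriodic (@[conjecture], open; time-periodic force) and
Literature.Analysis.FluidPDE.cheskidov_time_periodic_anomaly (Cheskidov2023 Thm 1.3, cite-only;
ν-dependent forces) — all live in Literature/Analysis/FluidPDE/ZerothLaw.lean, which the sub-problem
Statement itself imports (that file hosts meanEnergy/meanDissipation); no item of this route and not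
`closes` mentions any of them, so none is a hypothesis or debt here — needs-fact: none. The route's
own import list is trimmed to Literature.Analysis.FluidPDE.NSGalerkinFourier (galerkinRHS,
galerkinSubspace, freqBall, coefficient calculus; no named fact anywhere in its closure); the
explicit imports of LerayHopf and ZerothLaw were redundant with the Statement's imports and are
dropped (the file re-elaborates unchanged, lean check rc 0, same 62-constant cone). Every other
cited Prop in the cone (IsGlobalLerayHopf, IsWeakNSSolutionForcedOn, IsRealCoeff, IsSolenoidalCoeff)
is a DEFINITION with binders — summit-grade or Galerkin vocabulary — not a fact.

BADGE REPAIR (route-repair, 2026-08-17; needs_repair = skeleton.hides-summit on stmt-11414). The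
target X had been auto-badged crux ('underived-target', 2026-08-16, before WindLineFeedsTarget was
proved) and staffed DIRECTLY; its line (Cruxes/WindyGalerkinSteadyZerothLaw/Lines/birth.lean revs
1–8) landed real structure as supports of X — Galerkin shadowing of leaf-nondegenerate steady states
(HEART ⇒ X, BrezziRappazRaviart1980), leaf IFT, Foias–Temam generic leaf-nondegeneracy at every (ν,
m), the force dictionary, 13038 → X, P → BaireTransfer.BaireTarget (1145) — but every reshaping of
its ONE physics stub (A dense loud designer forces ⇒ P non-meagre ⇒ P′ menu form) is
summit-strength: P′ ALONE ⇒ CoherentStates.SteadyZerothLaw ⇒ AnomalousDissipation is accepted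
(Theorems/WindLineWindyGalerkinSteadyZerothLawMenuBirth.lean, anomalousDissipation_of_menuStub).
Cause, not accident: X is an ∃-force steady zeroth law, so a sufficient condition over a CLASS of
forces is itself a zeroth law; only a NAMED-force road is weaker in the useful sense, and those
roads are items already (#2 here; 2987/18425/18419 in MirrorVariety; 13038 in TaylorCertificates).
Repair: (i) P′ is NOT filed as a corrected crux C′ (summit-strength item); (ii) X re-badged target
and removed from the hypotheses of the deciding theorem, now `closes : CyclicWindLineLoud →
WindySteadyLimit → WindySteadyIsLerayHopf → WindLineFeedsTarget → Assembly → AnomalousDissipation :=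
fun hC hL hH hF hA => hA (hF hC) hL hH` (every binder consumed; four of five PROVED; lean check rc 0
against the live module, planner GlueCheck.lean) — the staffed leaf is #2, per the 11414 lead's own
LINE-STATUS recommendation; (iii) #3 and #5 DROPPED (intended as banked asides — the deployed gate
half-applies kind 'aside' and then fails every route-edit with KeyError 'aside', so they were
dropped to un-wedge the route; moot items 11416/11418 keep their statements for re-filing; never in
the cone; not a kill); (iv) #4 stays a ranked crux (negative side, kill witness landed) but is not a
`closes` binder (with #2 the old all-items closes had jointly inconsistent hypotheses). (v) 11414
RE-SKELETONED: the registered line of X is now `namedforce` (planner file line-namedforce.lean,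
skeleton check OK 2026-08-17T14:09Z, sha d9c0cb9f…) — stubs = VERBATIM the two open ν-uniformity
bets of #2's skeleton (stub_windLineReachesBoundedCalm, stub_windLineLoudIfBoundedCalm), composition
= #2's kernel-checked CyclicWindLineLoud_of followed by Theorems.windLineFeedsTarget_proof; the
hides-summit skeleton (P′) is superseded and its stub inactive. Statements unchanged (0 restated),
imports unchanged (0 dropped), needs-fact: none.

Novelty: Searches (2026-08-15): `lit search --hybrid "steady Navier-Stokes torus continuation homotopy
auxiliary parameter isola exact coherent states"` (12 book rows: Kuznetsov2023, HolmesLumley2012,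
FMRT2001 p.276 — none on a momentum axis); `lit search --source crossref "Kolmogorov flow traveling
waves"` (15; → AfendikovFiedlerLiebscher 2008 doi:10.3233/asy-2008-0901, abstract READ: a line of
equilibria of SPATIAL dynamics via Kirchgässner reduction, "neither induced by symmetries nor by
first integrals" — not a momentum axis), `… "Afendikov Fiedler Liebscher plane Kolmogorov flows
bifurcation without parameters"` (12; Liebscher2015 LNM 2117 doi:10.1007/978-3-319-10777-6), `…
"Kolmogorov flow uniform mean flow stability steady solutions"` (15; only RollinDubiefDoering2011
doi:10.1017/s0022112010006294 relevant-adjacent), `… "stationary Navier-Stokes periodic mean flow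
continuation"` zbMATH (2, irrelevant); `lit search --source arxiv "Baldi Montalto quasi-periodic
incompressible Euler flows 3D"` (1: arXiv:2003.14313, READ pp.1–6, Thm 1.1); `lit read
arXiv:2207.11008` pp.1–4 (FranzoiMontalto Thm 1.1–1.2, 2-D, uniform in ν); `lit vsearch "number of
stationary solutions of Navier-Stokes finite and odd for generic forces"` (10 books:
RobinsonRodrigoSadowski2016 p.337, ConstantinFoias1988, FMRT2001); `lit galaxy search "bifurcation
without parameters" --star all` (4 rows: FiedlerLiebscher 2001 preprint pdf:8482563966561275760;
irrelevant otherwise), `lit galaxy search "Kolmogorov flow Ga  [refs: 10.3233/asy-2008-0901, 10.1007/978-3-319-10777-6, 10.1017/s0022112010006294, 10.1017/s0022112090000829, 10.1063/1.1566753, 2003.14313, 2207.11008, doi:10.3233/asy-2008-0901, doi:10.1007/978-3-319-10777-6, doi:10.1017/s0022112010006294, doi:10.1017/s0022112090000829, doi:10.1063/1.1566753, FMRT2001, RobinsonRodrigoSadowski2016, ConstantinFoias1988, Nagata1990, BaldiMontalto2021, FranzoiMontalto2022]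

Barriers (technique_class: steady-states, continuation, galilean-symmetry, galerkin): - technique_class: steady-states, continuation, galilean-symmetry, galerkin
- Literature.Barriers.AnomalousDissipation.Cheskidov2023_thm13_not_forceRobustNoAnomaly: not engaged
— no no-anomaly conclusion is drawn from force-robust estimates; every item is about exact steady
states of the exact force (energy identity as an identity, s-independent); the negative crux
WindNeverLoud concerns steady Galerkin states only and uses steadiness, outside the force-robust
class (scope caveat (a)).
- Literature.Barriers.AnomalousDissipation.Marchioro1986_globalAttraction: CONSISTENT and
instructive — its 2026-08-15 audit (GravestModeLaminarAttractorSwept) exhibits exactly our windy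
shore for the first-mode planar force (marchioroDriftState, Λ_k = 4π²ν|k|² + 2πi(m·k), ν-uniform
energy ‖m‖² + 2α²/(π²m₀²)) and shows it is QUIET (⟨ν‖∇u‖²⟩ ≤ 8να²/m₀²): the shore is only the start
of the continuation, loud states must be interior crossings, and the force must be 3-D and
multi-state (cyclic force: no planar invariant subspace).
- Literature.Barriers.AnomalousDissipation.AlexakisDoering2006_energyDissipationBound: APPLIES to
every planar (x₃-independent) windy steady state (ε ≲ Re^{-1/2} at bounded energy, momentum or not):
witnesses of the target must be genuinely three-dimensional; the cyclic force (sin 2πx₃, sin 2πx₁,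
sin 2πx₂) has no coordinate-independent invariant subspace, and WindNeverLoud is automatically true
in 2-D — its content is 3-D.
- Literature.Barriers.AnomalousDissipation.Bardos

History (route lifecycle, newest last):
- 2026-08-16T03:42:05Z · AUTO-CRUX (backfill): WindyGalerkinSteadyZerothLaw — hypotheses of the deciding theorem that nothing in the route derives are cruxes (operator:999:586464)
- 2026-08-17T13:21:42Z · skeleton.hides-summit: stub_nonMeagreMenuLoudSteadyForces (stmt-AnomalousDissipation-11414) ⟷ summit (accepted theorem in Summits/AnomalousDissipation/AnomalousDissipation/Theorems/WindLineWindyGalerkinSteadyZerothLawMenuBirth.lean) (prover-line-stmt-AnomalousDissipation-11414-c3-0)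
- 2026-08-17T14:11:28Z · rev 4: dropped WindLineAvoidsLaminar, InviscidWindyShore — route-repair(badge): drop #3 WindLineAvoidsLaminar (11416) and #5 InviscidWindyShore (11418) — neither is load-bearing (never in the cone of closes; by the rout (planner-rbadge-AnomalousDissipation-WindLine-c56b32b7-0)
- 2026-08-17T14:50:35Z · CLOSED retired — not-a-thesis (restated, RULE-N): badge g2 on skeleton.hides-summit (11414) — the only open load-bearing binder of closes, CyclicWindLineLoud (11415), is ≥ summit by a closed tree term (closes ∘ landed (planner-rbadge-AnomalousDissipation-WindLine-c56b32b7-g2-0)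

sub-problem: AnomalousDissipation · status: closed(retired) · opened planner-plancard-AnomalousDissipation-Anomalo-7cad0987-0 2026-08-15T17:39:23Z · rev 6 · ledger route-AnomalousDissipation-WindLine
GENERATED by the gate from the ledger (D-0016/17). Provers cite these decls: `theorem foo : Summit.AnomalousDissipation.AnomalousDissipation.Theses.WindLine.<Decl> := …` in Summits/AnomalousDissipation/AnomalousDissipation/Theorems/<Name>.lean.
-/

namespace Summit.AnomalousDissipation.AnomalousDissipation.Theses.WindLine

open scoped BigOperators Topology Manifold Classical MeasureTheory ProbabilityTheory Matrix InnerProductSpace ComplexConjugate ContinuousMap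
open Filter Set Function TopologicalSpace MeasureTheory

attribute [summit_statement] _root_.AnomalousDissipation

open Literature.Turb

/-- item stmt-AnomalousDissipation-11414 · target (kind.auto-crux: conjecture-grade) · rank 0 · closed · moot by None · by planner
why it might fail: False if bounded-energy steady states, windy or calm, laminarise as ν→0 (a momentum-inclusive SteadyNeg 0222 composed with WindySteadyLimit); at fixed N bounded states are quiet (ν‖∇u‖² ≤ 4π²νN²E), so witnesses need N ≳ (ε/νE)^½ and Onsager-rough limits; the windy shore itself is quiet.
sources: Temam1979, ConstantinFoias1988, DoeringFoias2002, Cheskidov2023, DrivasEyink2019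
[target] X as in § Thesis — loud bounded steady Galerkin states with free momentum, along ν_j → 0⁺,
at infinitely many resolutions (card K1 without the reachability clause; MirrorVariety's target
minus HasZeroMean). -/
@[route_item "route-AnomalousDissipation-WindLine"]
def WindyGalerkinSteadyZerothLaw : Prop :=
  ∃ f : UnitAddTorus (Fin 3) → EuclideanSpace ℝ (Fin 3), Literature.Analysis.FunctionSpaces.Torus.IsSmooth f ∧ Literature.Analysis.FunctionSpaces.Torus.IsDivFree f ∧ Literature.Analysis.FunctionSpaces.Torus.HasZeroMean f ∧ ∃ (ν : ℕ → ℝ) (E ε : ℝ), (∀ j, 0 < ν j) ∧ Filter.Tendsto ν Filter.atTop (nhds 0) ∧ 0 < ε ∧ ∀ j, ∃ᶠ N in Filter.atTop, ∃ u : UnitAddTorus (Fin 3) → EuclideanSpace ℝ (Fin 3), (Literature.Analysis.FunctionSpaces.Torus.IsSmooth u ∧ Literature.Analysis.FunctionSpaces.Torus.IsDivFree u ∧ (∀ k ∉ Literature.Analysis.FunctionSpaces.Torus.freqBall N, UnitAddTorus.mFourierCoeff (Literature.Analysis.FunctionSpaces.EuclideanSpace.complexify ∘ u) k = 0) ∧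 ∀ a : UnitAddTorus (Fin 3) → EuclideanSpace ℝ (Fin 3), Literature.Analysis.FunctionSpaces.Torus.IsSmooth a → Literature.Analysis.FunctionSpaces.Torus.IsDivFree a → (∀ k ∉ (Literature.Analysis.FunctionSpaces.Torus.freqBall N).erase (0 : Fin 3 → ℤ), UnitAddTorus.mFourierCoeff (Literature.Analysis.FunctionSpaces.EuclideanSpace.complexify ∘ a) k = 0) → ∫ x, (inner ℝ (u x) (Literature.Analysis.FunctionSpaces.Torus.convect u a x) + ν j * inner ℝ (u x) (Literature.Analysis.FunctionSpaces.Torus.laplacian a x) + inner ℝ (f x) (a x)) = 0) ∧ ∫ x, ‖u x‖ ^ 2 ≤ E ∧ ε ≤ ν j * Literature.Analysis.FunctionSpaces.Torus.gradNormSq u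

/-- item stmt-AnomalousDissipation-11415 · crux · rank 2 · closed · moot by None · by planner
why it might fail: The wind-line may reach bounded energy only at warm states: in kit j001712 (K²=6) crossing loudness fell from 0.69–1.46 (ν=10⁻²) to ≤0.29 (ν=10⁻³) under ⟨|U|²⟩≤60, tracking the fixed-N cap 4π²νN²E; N-uniform loudness at bounded energy was never observed, and WindNeverLoud may simply be true.
sources: Nagata1990, Waleffe2003, FranceschiniTebaldiZironi1984, Okamoto1998, BrachetEtAl1983
[crux] card K1 made precise for ONE force and ONE wind direction: for the cyclic force f(x) = (sin
2πx₃, sin 2πx₁, sin 2πx₂) (odd, first-shell, genuinely three-dimensional) and e = (1, √2, √3) (e·k ≠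
0 for every k ∈ ℤ³∖0) there are ν_j → 0⁺, E, ε > 0 such that for every j and infinitely many N the
WIND-LINE — the connected component of the fixed-ν_j windy steady Galerkin variety V = {c ∈
galerkinSubspace(freqBall N) : c₀ ∈ ℝ·e, galerkinRHS ν_j ĝ c = 0} that reaches arbitrarily large
wind s — carries a state of total energy Σ|c_k|² ≤ E and dissipation ν_j·4π²Σ|k|²|c_k|² ≥ ε. Feeds
the target through WindLineFeedsTarget. [difficulty: XL] -/
@[route_item "route-AnomalousDissipation-WindLine"]
def CyclicWindLineLoud : Prop :=
  ∃ (ν : ℕ → ℝ) (E ε : ℝ), (∀ j, 0 < ν j) ∧ Filter.Tendsto ν Filter.atTop (nhds 0) ∧ 0 < ε ∧ ∀ j, ∃ᶠ N in Filter.atTop, ∀ (S : Finset (Fin 3 → ℤ)), S = Literature.Analysis.FunctionSpaces.Torus.freqBall N → ∀ V : Set (↥S → EuclideanSpace ℂ (Fin 3)), V = {c | c ∈ Literature.Analysis.FluidPDE.galerkinSubspace S ∧ (∃ s : ℝ, ∀ k : ↥S, (k : Fin 3 → ℤ) = 0 → c k = (s : ℂ) • !₂[(1 : ℂ), ((Real.sqrt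 2 : ℝ) : ℂ), ((Real.sqrt 3 : ℝ) : ℂ)]) ∧ Literature.Analysis.FluidPDE.galerkinRHS S (ν j) (fun k : ↥S => UnitAddTorus.mFourierCoeff (Literature.Analysis.FunctionSpaces.EuclideanSpace.complexify ∘ fun x : UnitAddTorus (Fin 3) => !₂[(fourier 1 (x 2) : ℂ).im, (fourier 1 (x 0) : ℂ).im, (fourier 1 (x 1) : ℂ).im]) (k : Fin 3 → ℤ)) c = 0} → ∃ c ∈ V, (∀ Λ : ℝ, ∃ c' ∈ connectedComponentIn V c, ∃ s : ℝ, (∀ k : ↥S, (k : Fin 3 → ℤ) = 0 → c' k = (s : ℂ) • !₂[(1 : ℂ), ((Real.sqrt 2 : ℝ) : ℂ), ((Real.sqrt 3 : ℝ) : ℂ)]) ∧ Λ ≤ s) ∧ ∑ k : ↥S, ‖c k‖ ^ 2 ≤ E ∧ ε ≤ ν j * (4 * Real.pi ^ 2 * ∑ k : ↥S, Literature.Analysis.FunctionSpaces.Torus.freqNormSq (k : Fin 3 → ℤ) * ‖c k‖ ^ 2)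

/-- item stmt-AnomalousDissipation-11417 · crux · rank 4 · closed · moot by None · by planner
why it might fail: False as soon as one smooth 3-D force has loud bounded wind-line states at unbounded resolution (CyclicWindLineLoud): all 135 calm crossings of j001712 are ×1.6–7 louder than the Stokes-connected state and sit at 70–80% of the cap; the energy identity gives only ν‖∇U‖² ≤ ‖f‖√E, nothing N-uniform.
sources: AlexakisDoering2006PLA, Cheskidov2023, OkamotoShoji1993, LucasKerswell2017, FoiasManleyRosaTemam2001
[crux] the negative universal of the line (kill criterion as a statement): for every smooth
divergence-free mean-zero force f, every direction e with e·k ≠ 0 on ℤ³∖0 and every E, ε > 0 there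
is ν₀ > 0 such that at EVERY resolution N and every 0 < ν < ν₀, every point of the wind-line
(component of the fixed-ν windy variety reaching arbitrarily large s) with total energy ≤ E has
dissipation ν·4π²Σ|k|²|c_k|² < ε. Trivial at fixed N (νN²E); the content is uniformity in N.
WindNeverLoud → ¬CyclicWindLineLoud (e = (1,√2,√3) is non-resonant); it is the wind-axis twin of
MirrorVariety.LaminarNeverLoud (stmt-2988), about a different component (fixed ν, varying s, instead
of s = 0, varying ν). [difficulty: XL] -/
@[route_item "route-AnomalousDissipation-WindLine", crux]
def WindNeverLoud : Prop :=
  ∀ f : UnitAddTorus (Fin 3) → EuclideanSpace ℝ (Fin 3), Literature.Analysis.FunctionSpaces.Torus.IsSmooth f → Literature.Analysis.FunctionSpaces.Torus.IsDivFree f → Literature.Analysis.FunctionSpaces.Torus.HasZeroMean f → ∀ e : EuclideanSpace ℝ (Fin 3), (∀ k : Fin 3 → ℤ, k ≠ 0 → ∑ i, e i * (k i : ℝ) ≠ 0) → ∀ E ε : ℝ, 0 < ε → ∃ ν₀ : ℝ, 0 < ν₀ ∧ ∀ (ν : ℝ) (N : ℕ) (S : Finset (Fin 3 → ℤ)), 0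 < ν → ν < ν₀ → S = Literature.Analysis.FunctionSpaces.Torus.freqBall N → ∀ V : Set (↥S → EuclideanSpace ℂ (Fin 3)), V = {c | c ∈ Literature.Analysis.FluidPDE.galerkinSubspace S ∧ (∃ s : ℝ, ∀ k : ↥S, (k : Fin 3 → ℤ) = 0 → c k = (s : ℂ) • Literature.Analysis.FunctionSpaces.EuclideanSpace.complexify e) ∧ Literature.Analysis.FluidPDE.galerkinRHS S ν (fun k : ↥S => UnitAddTorus.mFourierCoeff (Literature.Analysis.FunctionSpaces.EuclideanSpace.complexify ∘ f) (k : Fin 3 → ℤ)) c = 0} → ∀ c ∈ V, (∀ Λ : ℝ, ∃ c' ∈ connectedComponentIn V c, ∃ s : ℝ, (∀ k : ↥S, (k : Fin 3 → ℤ) = 0 → c' k = (s : ℂ) • Literature.Analysis.FunctionSpaces.EuclideanSpace.complexify e) ∧ Λ ≤ s) → ∑ k : ↥S, ‖c k‖ ^ 2 ≤ E → ν * (4 * Real.pi ^ 2 * ∑ k : ↥S, Literature.Analysis.FunctionSpaces.Torus.freqNormSq (k : Fin 3 → ℤ) * ‖c k‖ ^ 2) < ε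

/-- item stmt-AnomalousDissipation-11419 · support · rank 9 · closed · proved by Summit.AnomalousDissipation.AnomalousDissipation.Theorems.windyShoreUniform_proof (prover) · by planner
sources: RobinsonRodrigoSadowski2016, ConstantinFoias1988, BaldiMontalto2021, FoiasManleyRosaTemam2001
[support] card P1(a), provable now: the ν-UNIFORM windy shore at Galerkin level. For every N, real
solenoidal g with g₀ = 0 and e non-resonant on freqBall N there is C such that for every energy
radius R there is s₀ with: for all ν ≥ 0 and |s| ≥ s₀ a windy steady state with c₀ = s·e exists with
s²·Σ_{k≠0}|c_k|² ≤ C, and it is the only windy steady state at (ν, s) among those with Σ_{k≠0}|c_k|²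
≤ R (contraction for c̃ = M⁻¹(g − B̃(c̃,c̃)), M_k = 4π²ν|k|² + 2πi s(e·k) normal with |M_k| ≥ 2π|s|
min|e·k|; the tree's marchioroDriftState is the N = 1, 2-D instance). [difficulty: provable-now] -/
@[route_item "route-AnomalousDissipation-WindLine"]
def WindyShoreUniform : Prop :=
  ∀ (N : ℕ) (S : Finset (Fin 3 → ℤ)), S = Literature.Analysis.FunctionSpaces.Torus.freqBall N → ∀ g : ↥S → EuclideanSpace ℂ (Fin 3), g ∈ Literature.Analysis.FluidPDE.galerkinSubspace S → (∀ k : ↥S, (k : Fin 3 → ℤ) = 0 → g k = 0) → ∀ e : EuclideanSpace ℝ (Fin 3), (∀ k : ↥S, (k : Fin 3 → ℤ) ≠ 0 → ∑ i, e i * ((k : Fin 3 → ℤ) i : ℝ) ≠ 0) → ∃ C : ℝ, ∀ R : ℝ, ∃ s₀ : ℝ, ∀ ν : ℝ, 0 ≤ ν → ∀ s : ℝ, s₀ ≤ |s| → (∃ c ∈ Literature.Analysis.FluidPDE.galerkinSubspace S, (∀ k : ↥S, (k : Fin 3 → ℤ) = 0 → c k = (s : ℂ) • Literature.Analysis.FunctionSpaces.EuclideanSpace.complexify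 e) ∧ Literature.Analysis.FluidPDE.galerkinRHS S ν g c = 0 ∧ s ^ 2 * ∑ k : ↥S, (if (k : Fin 3 → ℤ) = 0 then 0 else ‖c k‖ ^ 2) ≤ C) ∧ ∀ c ∈ Literature.Analysis.FluidPDE.galerkinSubspace S, ∀ c' ∈ Literature.Analysis.FluidPDE.galerkinSubspace S, (∀ k : ↥S, (k : Fin 3 → ℤ) = 0 → c k = (s : ℂ) • Literature.Analysis.FunctionSpaces.EuclideanSpace.complexify e) → (∀ k : ↥S, (k : Fin 3 → ℤ) = 0 → c' k = (s : ℂ) • Literature.Analysis.FunctionSpaces.EuclideanSpace.complexify e) → Literature.Analysis.FluidPDE.galerkinRHS S ν g c = 0 → Literature.Analysis.FluidPDE.galerkinRHS S ν g c' = 0 → ∑ k : ↥S, (if (k : Fin 3 → ℤ) = 0 then 0 else ‖c k‖ ^ 2) ≤ R → ∑ k : ↥S, (if (k : Fin 3 → ℤ) = 0 then 0 else ‖c' k‖ ^ 2) ≤ R → c = c'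

/-- item stmt-AnomalousDissipation-11420 · support · rank 9 · closed · proved by Summit.AnomalousDissipation.AnomalousDissipation.Theorems.windLineReachesCalm_proof (prover) · by planner
sources: MilnorTDV1965, BasuPollackRoy2006, FoiasTemam1977, TemamNSNFA1995, Temam1979
[support] card P1(b), the odd-crossing theorem in its provable core: at fixed ν > 0, resolution N,
real solenoidal g with g₀ = 0, non-resonant e, if 0 is a regular value of c ↦ galerkinRHS ν g c on
the affine windy phase space {c ∈ galerkinSubspace : c₀ ∈ ℝ·e}, then every point whose connected
component in the windy variety reaches arbitrarily large s also reaches arbitrarily negative s in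
its component, and that component contains a CALM steady state (c₀ = 0). Proof map: energy identity
⇒ ‖c̃‖ ≤ ‖g‖/(4π²ν) uniformly in s (slabs |s| ≤ Λ compact); WindyShoreUniform ⇒ V ∩ {s > s₁} and V ∩
{s < −s₁} are single arcs; regular value ⇒ V is a closed 1-manifold, the component of the +∞ arc is
a properly embedded line whose two ends cannot both run into the single +∞ arc; intermediate value
theorem on s. [difficulty: M] -/
@[route_item "route-AnomalousDissipation-WindLine"]
def WindLineReachesCalm : Prop :=
  ∀ (N : ℕ) (S : Finset (Fin 3 → ℤ)), S = Literature.Analysis.FunctionSpaces.Torus.freqBall N → ∀ g : ↥S → EuclideanSpace ℂ (Fin 3), g ∈ Literature.Analysis.FluidPDE.galerkinSubspace S → (∀ k : ↥S, (k : Fin 3 → ℤ) = 0 → g k = 0) → ∀ e : EuclideanSpace ℝ (Fin 3), (∀ k : ↥S, (k : Fin 3 → ℤ) ≠ 0 → ∑ i, e i * ((k : Fin 3 → ℤ) i : ℝ) ≠ 0) → ∀ ν : ℝ, 0 < ν → ∀ V : Set (↥S → EuclideanSpace ℂ (Fin 3)), V = {c | c ∈ Literature.Analysis.FluidPDE.galerkinSubspace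 S ∧ (∃ s : ℝ, ∀ k : ↥S, (k : Fin 3 → ℤ) = 0 → c k = (s : ℂ) • Literature.Analysis.FunctionSpaces.EuclideanSpace.complexify e) ∧ Literature.Analysis.FluidPDE.galerkinRHS S ν g c = 0} → (∀ c ∈ V, ∀ w ∈ Literature.Analysis.FluidPDE.galerkinSubspace S, (∀ k : ↥S, (k : Fin 3 → ℤ) = 0 → w k = 0) → ∃ v ∈ Literature.Analysis.FluidPDE.galerkinSubspace S, (∃ t : ℝ, ∀ k : ↥S, (k : Fin 3 → ℤ) = 0 → v k = (t : ℂ) • Literature.Analysis.FunctionSpaces.EuclideanSpace.complexify e) ∧ fderiv ℝ (fun c : ↥S → EuclideanSpace ℂ (Fin 3) => Literature.Analysis.FluidPDE.galerkinRHS S ν g c) c v = w) → ∀ c ∈ V, (∀ Λ : ℝ, ∃ c' ∈ connectedComponentIn V c, ∃ s : ℝ, (∀ k : ↥S, (k : Fin 3 → ℤ) = 0 → c' k = (s : ℂ) • Literature.Analysis.FunctionSpaces.EuclideanSpace.complexify e) ∧ Λ ≤ s) → (∀ Λ : ℝ, ∃ c' ∈ connectedComponentIn V c, ∃ s : ℝ,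 (∀ k : ↥S, (k : Fin 3 → ℤ) = 0 → c' k = (s : ℂ) • Literature.Analysis.FunctionSpaces.EuclideanSpace.complexify e) ∧ s ≤ -Λ) ∧ ∃ c' ∈ connectedComponentIn V c, ∀ k : ↥S, (k : Fin 3 → ℤ) = 0 → c' k = 0

/-- item stmt-AnomalousDissipation-11421 · support · rank 9 · closed · proved by Summit.AnomalousDissipation.AnomalousDissipation.Theorems.WindySteadyLimit_proof (prover) · by planner
sources: Temam1979, ConstantinFoias1988, RobinsonRodrigoSadowski2016, Galdi2011
[support] assembly glue, provable now from tree material (Temam's existence proof run on the given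
zeros): at fixed ν > 0, from windy Galerkin states at infinitely many N with ∫|u_N|² ≤ E and
ν‖∇u_N‖² ≥ ε extract u ∈ L² ∩ H¹, weakly divergence free, solving the steady tested equations
against ALL smooth divergence-free fields (constants test trivially since ∫f = 0), with ∫|u|² ≤ E,
the ENERGY EQUATION ν‖∇u‖² = (f, u) (d = 3: b(u,u,ũ) = 0 for u ∈ H¹, ũ = u − ∫u) and hence ν‖∇u‖² =
lim (f, u_N) = lim ν‖∇u_N‖² ≥ ε (testing the Galerkin equations with a = u_N − ∫u_N gives ν‖∇u_N‖² =
(f, u_N) ≤ ‖f‖√E, the uniform H¹ bound; means |∫u_N|² ≤ E). [difficulty: provable-now] -/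
@[route_item "route-AnomalousDissipation-WindLine"]
def WindySteadyLimit : Prop :=
  ∀ (ν E ε : ℝ) (f : UnitAddTorus (Fin 3) → EuclideanSpace ℝ (Fin 3)), 0 < ν → Literature.Analysis.FunctionSpaces.Torus.IsSmooth f → Literature.Analysis.FunctionSpaces.Torus.IsDivFree f → Literature.Analysis.FunctionSpaces.Torus.HasZeroMean f → (∃ᶠ N in Filter.atTop, ∃ u : UnitAddTorus (Fin 3) → EuclideanSpace ℝ (Fin 3), (Literature.Analysis.FunctionSpaces.Torus.IsSmooth u ∧ Literature.Analysis.FunctionSpaces.Torus.IsDivFree u ∧ (∀ k ∉ Literature.Analysis.FunctionSpaces.Torus.freqBall N, UnitAddTorus.mFourierCoeff (Literature.Analysis.FunctionSpaces.EuclideanSpace.complexify ∘ u) k = 0) ∧ ∀ a : UnitAddTorus (Fin 3) → EuclideanSpace ℝ (Fin 3), Literature.Analysis.FunctionSpaces.Torus.IsSmooth a → Literature.Analysis.FunctionSpaces.Torus.IsDivFree a → (∀ k ∉ (Literature.Analysis.FunctionSpaces.Torus.freqBall N).erase (0 : Fin 3 → ℤ), UnitAddTorus.mFourierCoeff (Literature.Analysis.FunctionSpaces.EuclideanSpace.complexify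 ∘ a) k = 0) → ∫ x, (inner ℝ (u x) (Literature.Analysis.FunctionSpaces.Torus.convect u a x) + ν * inner ℝ (u x) (Literature.Analysis.FunctionSpaces.Torus.laplacian a x) + inner ℝ (f x) (a x)) = 0) ∧ ∫ x, ‖u x‖ ^ 2 ≤ E ∧ ε ≤ ν * Literature.Analysis.FunctionSpaces.Torus.gradNormSq u) → ∃ u : UnitAddTorus (Fin 3) → EuclideanSpace ℝ (Fin 3), MeasureTheory.MemLp u 2 MeasureTheory.volume ∧ Literature.Analysis.FunctionSpaces.Torus.MemSobolev 1 (Literature.Analysis.FunctionSpaces.EuclideanSpace.complexify ∘ u) ∧ Literature.Analysis.FunctionSpaces.Torus.IsWeaklyDivFree u ∧ (∀ w : UnitAddTorus (Fin 3) → EuclideanSpace ℝ (Fin 3), Literature.Analysis.FunctionSpaces.Torus.IsSmooth w → Literature.Analysis.FunctionSpaces.Torus.IsDivFree w → ∫ x, (inner ℝ (u x) (Literature.Analysis.FunctionSpaces.Torus.convect u w x) + ν * inner ℝ (u x) (Literature.Analysis.FunctionSpaces.Torus.laplacian w x) + inner ℝ (f x) (w x)) = 0) ∧ ∫ x, ‖u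 x‖ ^ 2 ≤ E ∧ ν * (Literature.Analysis.FunctionSpaces.Torus.eGradNormSq u).toReal = ∫ x, inner ℝ (f x) (u x) ∧ ε ≤ ν * (Literature.Analysis.FunctionSpaces.Torus.eGradNormSq u).toReal

/-- item stmt-AnomalousDissipation-11422 · support · rank 9 · closed · proved by Summit.AnomalousDissipation.AnomalousDissipation.Theorems.windySteadyIsLerayHopf_proof (prover) · by planner
sources: Galdi2000, DoeringFoias2002, RobinsonRodrigoSadowski2016, Hopf1951
[support] assembly glue, provable now: a field u ∈ L² ∩ H¹ on T³, weakly divergence free, solving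
the steady tested Navier–Stokes equations against all smooth divergence-free fields for a smooth
mean-zero force f, with the energy equation ν‖∇u‖² = (f, u), is — as the constant path — a global
Leray–Hopf solution from itself (weak form: the time derivative term integrates to −∫⟨u, ψ(0)⟩ and
cancels the datum; energy inequalities hold with equality; weak/strong continuity trivial), with
meanEnergy = ∫|u|² and meanDissipation = ν‖∇u‖² (time means of constants). No mean-zero hypothesis
anywhere: Torus.IsWeakNSSolutionForcedOn imposes none (cf. the tree's
marchioroSweptState_isGlobalLerayHopf and the constant-flow witness of
FrustratedForcesEnsembleCeilingBridge_refuted). [difficulty: provable-now] -/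
@[route_item "route-AnomalousDissipation-WindLine"]
def WindySteadyIsLerayHopf : Prop :=
  ∀ (ν : ℝ) (f u : UnitAddTorus (Fin 3) → EuclideanSpace ℝ (Fin 3)), 0 < ν → Literature.Analysis.FunctionSpaces.Torus.IsSmooth f → Literature.Analysis.FunctionSpaces.Torus.HasZeroMean f → MeasureTheory.MemLp u 2 MeasureTheory.volume → Literature.Analysis.FunctionSpaces.Torus.MemSobolev 1 (Literature.Analysis.FunctionSpaces.EuclideanSpace.complexify ∘ u) → Literature.Analysis.FunctionSpaces.Torus.IsWeaklyDivFree u → (∀ w : UnitAddTorus (Fin 3) → EuclideanSpace ℝ (Fin 3), Literature.Analysis.FunctionSpaces.Torus.IsSmooth w → Literature.Analysis.FunctionSpaces.Torus.IsDivFree w → ∫ x, (inner ℝ (u x) (Literature.Analysis.FunctionSpaces.Torus.convect u w x) + ν * inner ℝ (u x) (Literature.Analysis.FunctionSpaces.Torus.laplacian w x) + inner ℝ (f x) (w x)) = 0) → ν * (Literature.Analysis.FunctionSpaces.Torus.eGradNormSq u).toReal = ∫ x, inner ℝ (f x) (u x) → Literature.Analysis.FluidPDE.Torus.IsGlobalLerayHopf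 ν (fun _ => f) u (fun _ => u) ∧ Literature.Analysis.FluidPDE.meanEnergy (fun _ : ℝ => u) = ∫ x, ‖u x‖ ^ 2 ∧ Literature.Analysis.FluidPDE.meanDissipation ν (fun _ : ℝ => u) = ν * (Literature.Analysis.FunctionSpaces.Torus.eGradNormSq u).toReal

/-- item stmt-AnomalousDissipation-11423 · support · rank 9 · closed · proved by Summit.AnomalousDissipation.AnomalousDissipation.Theorems.windLineFeedsTarget_proof (prover) · by planner
sources: RobinsonRodrigoSadowski2016, ConstantinFoias1988
[support] glue, provable now: CyclicWindLineLoud → WindyGalerkinSteadyZerothLaw. A zero c of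
galerkinRHS on freqBall N is the coefficient vector of u = realTrigPoly (coeffExt c): smooth,
divergence free (isDivFree_realTrigPoly), band-limited to freqBall N, solving the tested equations
by sum_re_inner_galerkinField_test, with ∫|u|² = Σ|c_k|² and gradNormSq u = 4π²Σ|k|²|c_k|²
(Parseval); the cyclic force is smooth, divergence free, mean zero and its coefficient vector is
real solenoidal. [difficulty: provable-now] -/
@[route_item "route-AnomalousDissipation-WindLine"]
def WindLineFeedsTarget : Prop :=
  CyclicWindLineLoud → WindyGalerkinSteadyZerothLaw

/-- item stmt-AnomalousDissipation-11424 · assembly · rank 1 · closed · proved by Summit.AnomalousDissipation.AnomalousDissipation.Theorems.windLineAssembly_proof (prover) · by planner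
sources: Temam1979, DoeringFoias2002
[assembly] WindyGalerkinSteadyZerothLaw → WindySteadyLimit → WindySteadyIsLerayHopf →
AnomalousDissipation (the composition above; identical in content to the proved `closes`). -/
@[route_item "route-AnomalousDissipation-WindLine"]
def Assembly : Prop :=
  WindyGalerkinSteadyZerothLaw → WindySteadyLimit → WindySteadyIsLerayHopf → _root_.AnomalousDissipation

end Summit.AnomalousDissipation.AnomalousDissipation.Theses.WindLine
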